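import Summits.BirchSwinnertonDyer.BirchSwinnertonDyer.Theorems.Rank1ResidualX10bMuTransfer
import Summits.BirchSwinnertonDyer.BirchSwinnertonDyer.Theorems.Rank1ResidualX10bMainConjecture
import HarnessLib

/-!
# Class X10b (`p = 3` good ordinary, `E[3]` irreducible, `ρ̄_{E,3}` NOT surjective) — the `μ`-transfer
# at `3` reaches the X_A3 OBJECT and BOTH ranks: `KatoMuTransferThree` ∧ certificate ∧ rational main
# conjecture ⟹ `MazurMainConjecture W 3` ⟹ `BSD(E,3)` (rank `1` modulo the Schneider certificate)

HONEST FRAMING (cell `b2b-bsdres`, home `run/shared/lean/b2b/bsd-rank1-residual/`, unit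
`b2b-bsdres-x10`, N2 = X10b class lead, gen 35; verbatim in every file): the goal of the cell is to
DELETE the COMBINATION-SHAPED residual classes for ALL analytic-rank `≤ 1` curves over `ℚ` — "full
BSD formula for every rank `≤ 1` curve in class C" assembled STRICTLY from published theorems — so that
the rank-`≤ 1` remainder becomes exactly the CONSTRUCTION-SHAPED classes, which are TYPED
(missing-input `Prop`s), NOT attempted; this is not "finishing BSD". Research route; no claim beyond
the stated class; nothing is booked; X10b stays CONSTRUCTION-SHAPED (NEEDS X_A3).

**What this file adds (ladder BSD, rung K6, row A5 = N2 = X10b @ 3).** The cell `bsd-smallim`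
typed the `p = 3` `μ`-transfer as the obligation node `KatoMuTransferThree` (KOLY-MEMO v1.6 §5.7,
5.7.3 (ii); `Theorems/Rank1ResidualX10bMuTransfer.lean`, p407527) and proved the rank-`0` bridge
`x10b_bsdp_rankZero_of_katoMuTransferThree`, leaving "the rank-`1` half of X10b not touched". The
rank-`1` engine at an ODD prime is, however, already in the tree (unit x1b's
`Wuthrich2014.missingPPartAt_of_mainConjecture_of_rank_one_odd`, consumed at `p = 3` by x10 gen 6's
`X10.bsdp_three_rankOne_of_mazurMainConjecture`, p195323), and the `μ = 0 ⟹` Mazur-main-conjecture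
step is x9 gen 5's `mazurMainConjecture_neron_of_mu_eq_zero_of_rationalMC` (`X10bMuInvariant.lean`).
Composing them (no new mathematics, theorems only, no definition, no named fact minted):

* `mazurMainConjecture_of_katoMuTransferThree` — **the X_A3 object itself**: at an X10b pair,
  `KatoMuTransferThree` ∧ one unit coefficient of `L_3(f, α)` for the newforms of `E` (finite
  certificate `hcertA`) ∧ the RATIONAL main conjecture for `(E, 3)` (pointwise hypothesis `hrat`) ∧ the
  period units `h5`/`h3` ∧ modularity `hmodP` ⟹ `MazurMainConjecture W 3` (prover A's Néron-normalised
  integral cyclotomic main conjecture, `Rank1ResidualX1Defs`);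
* `bsdp_rankOne_of_katoMuTransferThree` — rank `1`: the same inputs ∧ Perrin-Riou–Schneider /
  Perrin-Riou 1987 / Mazur–Tate sigma at odd `p` ∧ GZK ∧ the per-pair Schneider certificate `hSch`
  ⟹ `BSDp W 3`;
* `bsdp_of_katoMuTransferThree` — BOTH ranks (the rank is read off `ClassX10`; `hSch` is invoked only
  at analytic rank `1`; Greenberg LNM 1716 Thm. 4.1 `hGr` serves rank `0`);
* `missingInputAt_of_katoMuTransferThree` — hence the typed outputs `Typed.X10.MissingInputAt W` and
  `Typed.X10b.MissingInputAt W`;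
* `…_of_yanZhu` twins with `hrat` supplied by Yan–Zhu 2026 Thm. 4.9 (named fact
  `YanZhu2026.thm49_charIdeal_eq_padicLFunction`, PUB, flag `YZ26@3-BF-ERL-Ohta`, via
  `rationalMC_of_yanZhu`).

So, in the kernel, the WHOLE X10b row reads: PUBLISHED named facts + ONE open node
(`KatoMuTransferThree`, the cell's theorem on paper at `p = 3`) + per-pair FINITE certificates (a unit
coefficient of `L_3(f, α)`; at rank `1` also `[T¹]L_3 ≠ 0`) ⟹ `BSD(E,3)` — the `p = 3` companion of the
K6 bridge `bsdpOnClassX9_of_katoMuTransfer` (p407118) in both ranks. Where `3` enters: only through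
`ClassX10` (`p = 3`); every engine used is stated for an odd prime. Nothing here is a class theorem;
labels and counts are unchanged.

References: [Kato2004Asterisque] Thm. 12.6, 17.13; [GreenbergLNM1716] §1 Conj. 1.11, Thm. 4.1;
[GreenbergVatsal2000] Prop. 3.7; [PerrinRiou1987] §1.4 Cor. 1.8; [BalakrishnanMullerStein2015]
Thm. 1.7; [CastellaEtAl2021] Thm. 5.1.4; [YanZhu2024MainConjNonCM] Thm. 4.9; [Miller2011LMS]
Def. 1.1; cell files X10-AUDIT.md §12, §40; HOME/pub/bsd-smallim/koly/KOLY-MEMO.md §5.7.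
-/

noncomputable section

open scoped Classical MatrixGroups ModularForm

open CongruenceSubgroup WeierstrassCurve Literature.NumberTheory.EllipticCurves
  Literature.NumberTheory.EllipticCurves.ModularForms Literature.NumberTheory.EllipticCurves.Rank1Residual
  Literature.NumberTheory.EllipticCurves.Rank1Residual.Typed
  Literature.NumberTheory.EllipticCurves.Wuthrich2014
  Summit.BirchSwinnertonDyer.BirchSwinnertonDyer.Theorems.Rank1ResidualX1Defs
  Summit.BirchSwinnertonDyer.BirchSwinnertonDyer.Rank1Residual

set_option autoImplicit false

namespace Summit.BirchSwinnertonDyer.Rank1Residual.X10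

variable (W : WeierstrassCurve ℚ) [W.IsElliptic] [W.IsGloballyMinimal] (p : ℕ) [Fact p.Prime]

/-! ### The X_A3 object from the `μ`-transfer -/

/-- **X10b: `KatoMuTransferThree` ∧ certificate ∧ rational main conjecture ⟹ Mazur's main conjecture
at `(E,3)` (the typed missing input X_A3 of row A5).** For `W/ℚ` globally minimal elliptic with
`ClassX10 W p` (so `p = 3`, good ordinary, `E[3]` irreducible) and `ρ̄_{E,3}` NOT surjective: the
rational main conjecture `hrat` for `(W, p)`, the period-unit facts `h5`/`h3`, modularity `hmodP`, the
open node `KatoMuTransferThree` and one `3`-adic unit coefficient of `L_3(f, α)` for the newforms `f` of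
`W` give `MazurMainConjecture W p`. Proof: `x10b_mu_eq_zero_of_katoMuTransferThree` (`μ = 0` for all
cyclotomic data) fed to `mazurMainConjecture_neron_of_mu_eq_zero_of_rationalMC`, whose conclusion is
prover A's conjecture verbatim; the `ϖ`-twisted certificate follows from `‖ϖ‖₃ = 1`
(`norm_periodRatio_eq_one_of_odd`). [cite: GreenbergVatsal2000, Prop. 3.7 and §3 Remark (3.4)]
[cite: GreenbergLNM1716, §1 Conj. 1.11] [cite: Kato2004Asterisque, Thm. 12.6 and 17.13 (p. 280)] -/
theorem mazurMainConjecture_of_katoMuTransferThree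
    (hrat : ∀ (κ : ZpExtension ℚ p) (γ : Field.absoluteGaloisGroup ℚ) {N : ℕ} [NeZero N]
      (f : CuspForm (Gamma0 N) 2), κ.IsCyclotomic → κ.IsTopGenerator γ → IsCyclotomicVariable p γ →
      IsNewformOf W f → ∀ (D : W.SelmerDualData κ γ), D.IsTorsion ∧
        ∃ (g : IwasawaAlgebra p) (k : ℤ), D.charIdeal = Ideal.span {g} ∧
          iwasawaToPowerSeries p g =
            PowerSeries.C ((p : ℚ_[p]) ^ k) * padicLFunction f (unitRoot W p : ℚ_[p]))
    (h5 : realPeriodRat_eq_unit_mul_plusPeriod) (h3 : realPeriodRat_eq_unit_mul_plusPeriod_three)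
    (hmodP : nonempty_modularParametrizationData) (hT3 : KatoMuTransferThree)
    (hX10 : ClassX10 W p) (hns : ¬ Surj W 3)
    (hcertA : ∀ {N : ℕ} [NeZero N] (f : CuspForm (Gamma0 N) 2), IsNewformOf W f →
      ∃ n : ℕ, ‖PowerSeries.coeff n (padicLFunction f (unitRoot W p : ℚ_[p]))‖ = 1) :
    MazurMainConjecture W p := by
  have hμ := x10b_mu_eq_zero_of_katoMuTransferThree hmodP hT3 W p hX10 hns hcertA
  obtain ⟨hp3, ⟨hgood, hord⟩, hirr, -⟩ := id hX10
  subst hp3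
  have hcert : ∀ [NeZero (W.conductorNorm ℤ)] (f : CuspForm (Gamma0 (W.conductorNorm ℤ)) 2),
      IsNewformOf W f → ∀ (ϖ : ℚ), (ϖ : ℝ) * W.realPeriodRat = plusPeriod f →
      ∃ n : ℕ, ‖PowerSeries.coeff n
        (PowerSeries.C (ϖ : ℚ_[3]) * padicLFunction f (unitRoot W 3 : ℚ_[3]))‖ = 1 := by
    intro _ f hf ϖ hϖeq
    obtain ⟨n, hn⟩ := hcertA f hf
    refine ⟨n, ?_⟩
    rw [PowerSeries.coeff_C_mul, norm_mul,
      norm_periodRatio_eq_one_of_odd h5 h3 W 3 (by decide) hgood hirr f hf ϖ hϖeq, one_mul]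
    exact hn
  exact mazurMainConjecture_neron_of_mu_eq_zero_of_rationalMC W 3 hrat h5 h3 (by decide) hgood hord
    hirr hμ hcert

/-- **The same with the rational main conjecture at `3` supplied by Yan–Zhu 2026 Thm. 4.9** (named
fact `YanZhu2026.thm49_charIdeal_eq_padicLFunction`, PUB, flag `YZ26@3-BF-ERL-Ohta`;
`rationalMC_of_yanZhu`): on X10b, the published record ∧ `KatoMuTransferThree` ∧ the finite
certificate ⟹ `MazurMainConjecture W 3`. [cite: YanZhu2024MainConjNonCM, Thm. 4.9 (§4.4)]
[cite: GreenbergVatsal2000, Prop. 3.7] -/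
theorem mazurMainConjecture_of_katoMuTransferThree_of_yanZhu
    (hYZ : YanZhu2026.thm49_charIdeal_eq_padicLFunction)
    (h5 : realPeriodRat_eq_unit_mul_plusPeriod) (h3 : realPeriodRat_eq_unit_mul_plusPeriod_three)
    (hmodP : nonempty_modularParametrizationData) (hT3 : KatoMuTransferThree)
    (hX10 : ClassX10 W p) (hns : ¬ Surj W 3)
    (hcertA : ∀ {N : ℕ} [NeZero N] (f : CuspForm (Gamma0 N) 2), IsNewformOf W f →
      ∃ n : ℕ, ‖PowerSeries.coeff n (padicLFunction f (unitRoot W p : ℚ_[p]))‖ = 1) :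
    MazurMainConjecture W p := by
  obtain ⟨hp3, ⟨hgood, hord⟩, hirr, -⟩ := id hX10
  have hp2 : p ≠ 2 := by omega
  have hgood' : W.HasGoodReductionAtPrime p := hp3 ▸ hgood
  have hord' : ¬ (p : ℤ) ∣ W.frobeniusTrace p := by subst hp3; exact hord
  have hirr' : W.HasIrreducibleModPGaloisRep p := by subst hp3; exact hirr
  exact mazurMainConjecture_of_katoMuTransferThree W p
    (rationalMC_of_yanZhu W p hYZ hp2 hgood' hord' hirr') h5 h3 hmodP hT3 hX10 hns hcertA

/-! ### Rank one, modulo the Schneider certificate -/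

/-- **X10b ∩ {r = 1}: `KatoMuTransferThree` ∧ certificate ∧ rational main conjecture ⟹ Miller's
`BSD(E,3)`, modulo the Schneider certificate.** Inputs beyond
`mazurMainConjecture_of_katoMuTransferThree`: the PUBLISHED named facts Perrin-Riou–Schneider at odd
`p` (`hS`, BMS 2016 Thm. 1.7), Perrin-Riou 1987 §1.4 at odd `p` (`hPR`), the Mazur–Tate sigma function
at odd `p` (`hMT`), Gross–Zagier–Kolyvagin (`hGZK`), and the per-pair certificate `hSch`
(non-degeneracy of THE canonical cyclotomic `3`-adic height, ⟺ `[T¹]L_3(E,T) ≠ 0`). Deduction: x10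
gen 6's `X10.bsdp_three_rankOne_of_mazurMainConjecture` (unit x1b's odd-prime rank-one engine, which
carries NO hypothesis on the image of `ρ̄_{E,3}`). [cite: PerrinRiou1987, §1.4 Cor. 1.8]
[cite: BalakrishnanMullerStein2015, Thm. 1.7] [cite: Miller2011LMS, Def. 1.1 (arXiv:1010.2431 p. 3)] -/
theorem bsdp_rankOne_of_katoMuTransferThree
    (hrat : ∀ (κ : ZpExtension ℚ p) (γ : Field.absoluteGaloisGroup ℚ) {N : ℕ} [NeZero N]
      (f : CuspForm (Gamma0 N) 2), κ.IsCyclotomic → κ.IsTopGenerator γ → IsCyclotomicVariable p γ →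
      IsNewformOf W f → ∀ (D : W.SelmerDualData κ γ), D.IsTorsion ∧
        ∃ (g : IwasawaAlgebra p) (k : ℤ), D.charIdeal = Ideal.span {g} ∧
          iwasawaToPowerSeries p g =
            PowerSeries.C ((p : ℚ_[p]) ^ k) * padicLFunction f (unitRoot W p : ℚ_[p]))
    (hS : Schneider1985_order_charGenerator_odd) (hPR : perrinRiou_rankOne_leadingTerms_odd)
    (hMT : mazur_tate_sigma_exists_odd)
    (h5 : realPeriodRat_eq_unit_mul_plusPeriod) (h3 : realPeriodRat_eq_unit_mul_plusPeriod_three)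
    (hmodP : nonempty_modularParametrizationData)
    (hGZK : rank_eq_analyticRank_of_analyticRank_le_one) (hT3 : KatoMuTransferThree)
    (hX10 : ClassX10 W p) (hns : ¬ Surj W 3) (hr1 : W.analyticRank = 1)
    (hSch : ∀ Dh : PAdicHeightData W p, Dh.IsCanonical → SchneiderConjecture Dh)
    (hcertA : ∀ {N : ℕ} [NeZero N] (f : CuspForm (Gamma0 N) 2), IsNewformOf W f →
      ∃ n : ℕ, ‖PowerSeries.coeff n (padicLFunction f (unitRoot W p : ℚ_[p]))‖ = 1) :
    BSDp W p := by
  have hMC := mazurMainConjecture_of_katoMuTransferThree W p hrat h5 h3 hmodP hT3 hX10 hns hcertA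
  obtain ⟨hp3, -⟩ := id hX10
  subst hp3
  exact Summit.BirchSwinnertonDyer.BirchSwinnertonDyer.Theorems.Rank1ResidualX10bMainConjecture.X10.bsdp_three_rankOne_of_mazurMainConjecture
    W hS hPR hMT hmodP hGZK hX10 hr1 hSch hMC

/-! ### Both ranks -/

/-- **X10b, BOTH ranks: `KatoMuTransferThree` ∧ certificate ∧ rational main conjecture ⟹ Miller's
`BSD(E,3)`** — at analytic rank `1` modulo the Schneider certificate (`hSch`, only invoked when
`ord_{s=1} L(E,s) = 1`); at rank `0` Greenberg LNM 1716 Thm. 4.1 (`hGr`). The rank is read off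
`ClassX10`. Deduction: `mazurMainConjecture_of_katoMuTransferThree`, then x10 gen 6's
`X10.bsdp_three_of_mazurMainConjecture`. This is the kernel form of "row A5 = PUBLISHED facts + the one
open node `KatoMuTransferThree` + finite per-pair certificates", the `p = 3` companion of the K6 bridge
`bsdpOnClassX9_of_katoMuTransfer` in both ranks. [cite: GreenbergLNM1716, Thm. 4.1 (p. 102)]
[cite: PerrinRiou1987, §1.4 Cor. 1.8] [cite: CastellaEtAl2021, Thm. 5.1.4 and its proof (§5.1.3)]
[cite: Miller2011LMS, Def. 1.1 (arXiv:1010.2431 p. 3)] -/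
theorem bsdp_of_katoMuTransferThree
    (hrat : ∀ (κ : ZpExtension ℚ p) (γ : Field.absoluteGaloisGroup ℚ) {N : ℕ} [NeZero N]
      (f : CuspForm (Gamma0 N) 2), κ.IsCyclotomic → κ.IsTopGenerator γ → IsCyclotomicVariable p γ →
      IsNewformOf W f → ∀ (D : W.SelmerDualData κ γ), D.IsTorsion ∧
        ∃ (g : IwasawaAlgebra p) (k : ℤ), D.charIdeal = Ideal.span {g} ∧
          iwasawaToPowerSeries p g =
            PowerSeries.C ((p : ℚ_[p]) ^ k) * padicLFunction f (unitRoot W p : ℚ_[p]))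
    (hS : Schneider1985_order_charGenerator_odd) (hPR : perrinRiou_rankOne_leadingTerms_odd)
    (hMT : mazur_tate_sigma_exists_odd) (hGr : greenberg_charValue_rankZero)
    (h5 : realPeriodRat_eq_unit_mul_plusPeriod) (h3 : realPeriodRat_eq_unit_mul_plusPeriod_three)
    (hmodP : nonempty_modularParametrizationData)
    (hGZK : rank_eq_analyticRank_of_analyticRank_le_one) (hT3 : KatoMuTransferThree)
    (hX10 : ClassX10 W p) (hns : ¬ Surj W 3)
    (hSch : W.analyticRank = 1 → ∀ Dh : PAdicHeightData W p, Dh.IsCanonical → SchneiderConjecture Dh)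
    (hcertA : ∀ {N : ℕ} [NeZero N] (f : CuspForm (Gamma0 N) 2), IsNewformOf W f →
      ∃ n : ℕ, ‖PowerSeries.coeff n (padicLFunction f (unitRoot W p : ℚ_[p]))‖ = 1) :
    BSDp W p := by
  have hMC := mazurMainConjecture_of_katoMuTransferThree W p hrat h5 h3 hmodP hT3 hX10 hns hcertA
  obtain ⟨hp3, -⟩ := id hX10
  subst hp3
  exact Summit.BirchSwinnertonDyer.BirchSwinnertonDyer.Theorems.Rank1ResidualX10bMainConjecture.X10.bsdp_three_of_mazurMainConjecture
    W hS hPR hMT hGr hmodP hGZK hX10 hSch hMC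

/-- **Hence the typed outputs on X10b are inhabited by the `μ`-transfer road**: under the hypotheses of
`bsdp_of_katoMuTransferThree`, both `Typed.X10.MissingInputAt W` (x10's typing of the class X10) and
`Typed.X10b.MissingInputAt W` (`= MissingPPartAt W 3`, the merged X9 ∪ X10b currency) hold.
Bookkeeping. [cite: Miller2011LMS, Def. 1.1] [cite: PerrinRiou1987, §1.4 Cor. 1.8] -/
theorem missingInputAt_of_katoMuTransferThree
    (hrat : ∀ (κ : ZpExtension ℚ p) (γ : Field.absoluteGaloisGroup ℚ) {N : ℕ} [NeZero N]
      (f : CuspForm (Gamma0 N) 2), κ.IsCyclotomic → κ.IsTopGenerator γ → IsCyclotomicVariable p γ →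
      IsNewformOf W f → ∀ (D : W.SelmerDualData κ γ), D.IsTorsion ∧
        ∃ (g : IwasawaAlgebra p) (k : ℤ), D.charIdeal = Ideal.span {g} ∧
          iwasawaToPowerSeries p g =
            PowerSeries.C ((p : ℚ_[p]) ^ k) * padicLFunction f (unitRoot W p : ℚ_[p]))
    (hS : Schneider1985_order_charGenerator_odd) (hPR : perrinRiou_rankOne_leadingTerms_odd)
    (hMT : mazur_tate_sigma_exists_odd) (hGr : greenberg_charValue_rankZero)
    (h5 : realPeriodRat_eq_unit_mul_plusPeriod) (h3 : realPeriodRat_eq_unit_mul_plusPeriod_three)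
    (hmodP : nonempty_modularParametrizationData)
    (hGZK : rank_eq_analyticRank_of_analyticRank_le_one) (hT3 : KatoMuTransferThree)
    (hX10 : ClassX10 W p) (hns : ¬ Surj W 3)
    (hSch : W.analyticRank = 1 → ∀ Dh : PAdicHeightData W p, Dh.IsCanonical → SchneiderConjecture Dh)
    (hcertA : ∀ {N : ℕ} [NeZero N] (f : CuspForm (Gamma0 N) 2), IsNewformOf W f →
      ∃ n : ℕ, ‖PowerSeries.coeff n (padicLFunction f (unitRoot W p : ℚ_[p]))‖ = 1) :
    Typed.X10.MissingInputAt W ∧ Typed.X10b.MissingInputAt W := by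
  have hMC := mazurMainConjecture_of_katoMuTransferThree W p hrat h5 h3 hmodP hT3 hX10 hns hcertA
  obtain ⟨hp3, -⟩ := id hX10
  subst hp3
  have hX : Typed.X10.MissingInputAt W :=
    Summit.BirchSwinnertonDyer.BirchSwinnertonDyer.Theorems.Rank1ResidualX10bMainConjecture.X10.missingInputAt_of_mazurMainConjecture
      W hS hPR hMT hGr hmodP hGZK hX10 hSch hMC
  exact ⟨hX, (Typed.X10b.missingInputAt_iff_x10 W hns).mpr hX⟩

/-! ### Both ranks with Yan–Zhu 2026 Thm. 4.9 as the rational main conjecture -/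

/-- **X10b, BOTH ranks, every binder a PUBLISHED named fact, the open node, or a finite certificate**:
Yan–Zhu 2026 Thm. 4.9 (`hYZ`, PUB, flag `YZ26@3-BF-ERL-Ohta`) supplies the rational main conjecture at
`3`; Perrin-Riou–Schneider / Perrin-Riou 1987 / Mazur–Tate at odd `p`, Greenberg Thm. 4.1, the period
units, modularity, GZK are the published record; `KatoMuTransferThree` is the cell's `μ`-transfer at
`3` (paper, OPEN node); `hcertA` (a unit coefficient of `L_3(f, α)`) and, at rank `1`, `hSch`
(`[T¹]L_3 ≠ 0`) are per-pair finite certificates. Conclusion: Miller's `BSD(E,3)`. Nothing booked.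
[cite: YanZhu2024MainConjNonCM, Thm. 4.9 (§4.4)] [cite: GreenbergLNM1716, Thm. 4.1 (p. 102)]
[cite: PerrinRiou1987, §1.4 Cor. 1.8] [cite: Miller2011LMS, Def. 1.1 (arXiv:1010.2431 p. 3)] -/
theorem bsdp_of_katoMuTransferThree_of_yanZhu
    (hYZ : YanZhu2026.thm49_charIdeal_eq_padicLFunction)
    (hS : Schneider1985_order_charGenerator_odd) (hPR : perrinRiou_rankOne_leadingTerms_odd)
    (hMT : mazur_tate_sigma_exists_odd) (hGr : greenberg_charValue_rankZero)
    (h5 : realPeriodRat_eq_unit_mul_plusPeriod) (h3 : realPeriodRat_eq_unit_mul_plusPeriod_three)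
    (hmodP : nonempty_modularParametrizationData)
    (hGZK : rank_eq_analyticRank_of_analyticRank_le_one) (hT3 : KatoMuTransferThree)
    (hX10 : ClassX10 W p) (hns : ¬ Surj W 3)
    (hSch : W.analyticRank = 1 → ∀ Dh : PAdicHeightData W p, Dh.IsCanonical → SchneiderConjecture Dh)
    (hcertA : ∀ {N : ℕ} [NeZero N] (f : CuspForm (Gamma0 N) 2), IsNewformOf W f →
      ∃ n : ℕ, ‖PowerSeries.coeff n (padicLFunction f (unitRoot W p : ℚ_[p]))‖ = 1) :
    BSDp W p := by
  obtain ⟨hp3, ⟨hgood, hord⟩, hirr, -⟩ := id hX10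
  have hp2 : p ≠ 2 := by omega
  have hgood' : W.HasGoodReductionAtPrime p := hp3 ▸ hgood
  have hord' : ¬ (p : ℤ) ∣ W.frobeniusTrace p := by subst hp3; exact hord
  have hirr' : W.HasIrreducibleModPGaloisRep p := by subst hp3; exact hirr
  exact bsdp_of_katoMuTransferThree W p (rationalMC_of_yanZhu W p hYZ hp2 hgood' hord' hirr') hS hPR
    hMT hGr h5 h3 hmodP hGZK hT3 hX10 hns hSch hcertA

/-- **The typed outputs with Yan–Zhu as the rational main conjecture** (bookkeeping twin of
`missingInputAt_of_katoMuTransferThree`). [cite: YanZhu2024MainConjNonCM, Thm. 4.9 (§4.4)]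
[cite: Miller2011LMS, Def. 1.1] -/
theorem missingInputAt_of_katoMuTransferThree_of_yanZhu
    (hYZ : YanZhu2026.thm49_charIdeal_eq_padicLFunction)
    (hS : Schneider1985_order_charGenerator_odd) (hPR : perrinRiou_rankOne_leadingTerms_odd)
    (hMT : mazur_tate_sigma_exists_odd) (hGr : greenberg_charValue_rankZero)
    (h5 : realPeriodRat_eq_unit_mul_plusPeriod) (h3 : realPeriodRat_eq_unit_mul_plusPeriod_three)
    (hmodP : nonempty_modularParametrizationData)
    (hGZK : rank_eq_analyticRank_of_analyticRank_le_one) (hT3 : KatoMuTransferThree)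
    (hX10 : ClassX10 W p) (hns : ¬ Surj W 3)
    (hSch : W.analyticRank = 1 → ∀ Dh : PAdicHeightData W p, Dh.IsCanonical → SchneiderConjecture Dh)
    (hcertA : ∀ {N : ℕ} [NeZero N] (f : CuspForm (Gamma0 N) 2), IsNewformOf W f →
      ∃ n : ℕ, ‖PowerSeries.coeff n (padicLFunction f (unitRoot W p : ℚ_[p]))‖ = 1) :
    Typed.X10.MissingInputAt W ∧ Typed.X10b.MissingInputAt W := by
  obtain ⟨hp3, ⟨hgood, hord⟩, hirr, -⟩ := id hX10
  have hp2 : p ≠ 2 := by omega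
  have hgood' : W.HasGoodReductionAtPrime p := hp3 ▸ hgood
  have hord' : ¬ (p : ℤ) ∣ W.frobeniusTrace p := by subst hp3; exact hord
  have hirr' : W.HasIrreducibleModPGaloisRep p := by subst hp3; exact hirr
  exact missingInputAt_of_katoMuTransferThree W p (rationalMC_of_yanZhu W p hYZ hp2 hgood' hord' hirr')
    hS hPR hMT hGr h5 h3 hmodP hGZK hT3 hX10 hns hSch hcertA

end Summit.BirchSwinnertonDyer.Rank1Residual.X10

end
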